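import Mathlib
import Summits.MatrixMultiplication.MatrixMultiplication.Theses.HiddenToeplitzCorners
import Summits.MatrixMultiplication.MatrixMultiplication.Cruxes.HiddenCorners.LawOfEnds
import Summits.MatrixMultiplication.MatrixMultiplication.Cruxes.HiddenCorners.WidthOne
import Summits.MatrixMultiplication.MatrixMultiplication.Cruxes.HiddenCorners.ApolarKernelPlacement
import Summits.MatrixMultiplication.MatrixMultiplication.Theorems.HiddenToeplitzCornersToeplitzLikeDetCost
import Summits.MatrixMultiplication.MatrixMultiplication.Theorems.HiddenToeplitzCornersAndrewsLifting
import Summits.MatrixMultiplication.MatrixMultiplication.Theorems.HiddenToeplitzCornersCostGlue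
import Summits.MatrixMultiplication.MatrixMultiplication.Theorems.HiddenToeplitzCornersLiftGlue

/-!
# Composition designs — honest Toeplitz SP pencils exist for EVERY `r`; the size-free law of ends is false
# (crux-strategist REDIRECT r1, second opinion, planner-cstrat-stmt-MatrixMultiplication-7492-r1-0, 2026-08-17)

Companion of `STRATEGY-CENSUS.md` (gen 4).  Crux `HiddenCorners` (stmt-MatrixMultiplication-7492), route HiddenToeplitzCorners.
This is a WORKFILE (typed statements; `sorry` only where a paper proof is in the census and a machine check in `exp/`).

## What is here

* `hiddenCorners_implies_summit` — PROVED (no sorry): all four co-binders of the route's `closes` are landed theorems, so the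
  crux ALONE implies the summit `ω(ℂ) = 2`.  This is the theorem that makes the crux summit-strength (payload item (3)).
* `hessPencil` — the lower-Hessenberg honest Toeplitz pencil of a step labelling `a : ℕ → (M_r →ₗ ℂ)` with superdiagonal `−ℓ`.
  Its determinant is the classical Toeplitz–Hessenberg composition sum `Σ_{compositions (c₁,…,c_m) of N} ℓ^{N−m} Π a_{cᵢ−1}`
  (Merca, Spec. Matrices 1 (2013), doi:10.2478/spma-2013-0003; recurrence form `det_hessPencil_succ`, typed, paper proof = Laplace
  expansion along the last column).
* `honestSP_all_r` — **UNIVERSALITY** (census §1, Theorem U): for every `r ≥ 1` there are `N` and an honest Toeplitz pencil `T` on `M_r`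
  with `det T(X) = r! · (X 0 0)^{N−r} · det X`; in particular `SplitSP r N 1 T`.  Proof (census §1.2–1.3): an `(r,N)`-COMPOSITION DESIGN —
  `r · r!` distinct step sizes `x_{σ,a}` (`σ ∈ S_r`, `a < r`) whose only sub-multisets with sum `N` are the `r!` sets `{x_{σ,a} : a < r}` —
  exists for every `r` by a balanced-digit construction with `N = exp(O(r² log r))`; labelling step `x_{σ,a}` by `sgn(σ)^{[a=0]} · X_{a,σ a}`
  makes the composition sum collapse to `r! ℓ^{N−r} Σ_σ sgn σ Π_a X_{a σ a}`.
* `r3Instance` / `r3Instance_det` — the EXPLICIT `r = 3` design: `N = 105`, eleven nonzero subdiagonals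
  `{25,27,29,31,32,36,37,39,42,45,50}` (= steps `26,28,30,32,33,37,38,40,43,46,51` minus one), superdiagonal `−X₀₀`,
  `det = 6 · X₀₀^102 · det X` (machine-checked exactly mod `2^61−1` at random points + the combinatorial certificate,
  `exp/verify_r3.py`; typed here as a prover target).
* CONSEQUENCES, PROVED from `honestSP_all_r` (one `sorry` upstream, none in the derivations): `not_widthOneLaw`, `not_splitNeutralLaw`
  (EVERY `c, k`), `not_lawOfEnds`, and `not_honestHankelRankLeTwo` (from the typed Hankel instance).  The negation door
  `LawOfEnds.splitNeutralLaw_refutes` is therefore VACUOUS: no size-free polynomial law in the split width `d` is true.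
* `oneSided_lower_bound` — typed (census §2, Theorem L): an SP pencil of upper bandwidth one has `C(2r,r) ≤ (N+1)^3`, from
  Andrews–Forbes (STOC 2022, arXiv:2112.00792) Thm 1.3 `dim ∂_{<∞}(f) ≥ C(2r,r)` for every nonzero `f ∈ (det_r)` and the containment
  `∂_{<∞}(det hessPencil) ⊆ span{ℓ^e · [t^N](A(t)^u t^s) : e,u,s ≤ N}`.  So the universal (one-sided) class cannot reach `N ≤ r^{2+ε}`.
-/

set_option linter.dupNamespace false
set_option linter.unusedVariables false

namespace Summit.MatrixMultiplication.MatrixMultiplication.Cruxes.HiddenCorners.CompositionDesigns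

open Summit.MatrixMultiplication.MatrixMultiplication.Theses.HiddenToeplitzCorners
open Summit.MatrixMultiplication.MatrixMultiplication.Theorems
open Summit.MatrixMultiplication.MatrixMultiplication.Cruxes.HiddenCorners.LawOfEnds
  (shiftZ SplitSP SplitNeutralLaw LawOfEnds splitNeutralLaw_refutes)
open Summit.MatrixMultiplication.MatrixMultiplication.Cruxes.HiddenCorners.WidthOne (WidthOneLaw)
open Summit.MatrixMultiplication.MatrixMultiplication.Cruxes.HiddenCorners.ApolarKernelPlacement
  (hankelPencil HonestHankelRankLeTwo)
open scoped BigOperators Matrix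
open Filter

/-! ## 0. The crux is summit-strength: `HiddenCorners → ω(ℂ) = 2`, unconditionally -/

/-- **Summit strength (PROVED).**  Every co-hypothesis of the route's deciding theorem `closes` is a landed theorem
(`andrewsLifting_proof`, `ToeplitzLikeDetCost_of`, `costGlue_proof`, `liftGlue_proof`), so the crux alone gives the summit. -/
theorem hiddenCorners_implies_summit : HiddenCorners → _root_.MatrixMultiplication := fun h =>
  closes andrewsLifting_proof ToeplitzLikeDetCost_of h costGlue_proof liftGlue_proof

/-! ## 1. Hessenberg–Toeplitz pencils and composition designs -/

/-- The lower-Hessenberg honest Toeplitz pencil with step labelling `a` (entry `a (i−j) X` on and below the diagonal)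
and superdiagonal `−ℓ X`.  Every entry is a linear form in `X`; `X ↦ hessPencil r N a ℓ X` is a linear pencil whose
values are honest Toeplitz matrices (hence of split Stein width `1`). -/
def hessPencil (r N : ℕ) (a : ℕ → (Matrix (Fin r) (Fin r) ℂ →ₗ[ℂ] ℂ)) (ℓ : Matrix (Fin r) (Fin r) ℂ →ₗ[ℂ] ℂ)
    (X : Matrix (Fin r) (Fin r) ℂ) : Matrix (Fin N) (Fin N) ℂ :=
  Matrix.of fun i j : Fin N =>
    if (j : ℕ) ≤ (i : ℕ) then a ((i : ℕ) - (j : ℕ)) X else if (j : ℕ) = (i : ℕ) + 1 then -(ℓ X) else 0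

/-- **Toeplitz–Hessenberg recurrence** (typed; classical — Merca 2013, Thm 1; paper proof: expand along the last column).
`D_{N+1} = Σ_{k=0}^{N} ℓ^k · a_k · D_{N-k}`, i.e. `det = Σ_{compositions} ℓ^{N−#parts} Π a_{part−1}`. -/
theorem det_hessPencil_succ (r N : ℕ) (a : ℕ → (Matrix (Fin r) (Fin r) ℂ →ₗ[ℂ] ℂ))
    (ℓ : Matrix (Fin r) (Fin r) ℂ →ₗ[ℂ] ℂ) (X : Matrix (Fin r) (Fin r) ℂ) :
    (hessPencil r (N + 1) a ℓ X).det =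
      ∑ k ∈ Finset.range (N + 1), (ℓ X) ^ k * a k X * (hessPencil r (N - k) a ℓ X).det := by
  sorry

/-- The linear form `X ↦ X a b`. -/
def entryForm (r : ℕ) (a b : Fin r) : Matrix (Fin r) (Fin r) ℂ →ₗ[ℂ] ℂ where
  toFun X := X a b
  map_add' X Y := rfl
  map_smul' c X := rfl

/-- An `(r, N)`-COMPOSITION DESIGN: injective step sizes `x (σ, a) ≥ 2` (so the diagonal `a 0` stays free/zero) with every
designed row summing to `N`, such that the only multisets of slots whose steps sum to `N` are the designed rows. -/
structure Design (r N : ℕ) where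
  step : Equiv.Perm (Fin r) × Fin r → ℕ
  inj : Function.Injective step
  two_le : ∀ s, 2 ≤ step s
  row_sum : ∀ σ : Equiv.Perm (Fin r), ∑ a : Fin r, step (σ, a) = N
  only : ∀ m : Multiset (Equiv.Perm (Fin r) × Fin r), (m.map step).sum = N →
    ∃ σ : Equiv.Perm (Fin r), m = (Finset.univ : Finset (Fin r)).val.map fun a => (σ, a)

/-- The step labelling of a design: step `x_{σ,a}` carries `sgn(σ)^{[a = 0]} · X_{a, σ a}` on subdiagonal `x_{σ,a} − 1`;
all other subdiagonals (including the main diagonal) are zero. -/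
noncomputable def Design.label {r N : ℕ} (D : Design r N) (k : ℕ) : Matrix (Fin r) (Fin r) ℂ →ₗ[ℂ] ℂ :=
  by
    classical
    exact if h : ∃ s, D.step s = k + 1 then
      (let s := Classical.choose h
       (if (s.2 : ℕ) = 0 then ((Equiv.Perm.sign s.1 : ℤ) : ℂ) else 1) • entryForm r s.2 (s.1 s.2))
    else 0

/-- **Design ⇒ determinant identity** (typed; census §1.2): the composition sum of a design pencil collapses to
`r! · ℓ^{N−r} · det X`. -/
theorem det_of_design {r N : ℕ} (D : Design r N) (ℓ : Matrix (Fin r) (Fin r) ℂ →ₗ[ℂ] ℂ)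
    (X : Matrix (Fin r) (Fin r) ℂ) :
    (hessPencil r N D.label ℓ X).det = (Nat.factorial r : ℂ) * (ℓ X) ^ (N - r) * X.det := by
  sorry

/-- **Designs exist for every `r ≥ 1`** (typed; census §1.3, balanced-digit construction, `N = exp(O(r² log r))`;
for `r = 3` an explicit design with `N = 105` is `r3Instance` below). -/
theorem design_exists (r : ℕ) (hr : 1 ≤ r) : ∃ N : ℕ, Nonempty (Design r N) := by
  sorry

/-! ## 2. Universality in the crux's currency and the death of the size-free laws -/

/-- **Theorem U (universality), crux currency.**  For every `r ≥ 1` some honest Toeplitz pencil on `M_r` is split-SP of width one: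
`SplitSP r N 1 T` (generators `G₀ = H₀ = e₀`; nonsingular at `X = 1` since `det = r!`; singular on `det X = 0`).
Typed with `sorry`: follows from `design_exists` + `det_of_design` (with `ℓ = X₀₀`) + the honest-Toeplitz split identity
(landed pattern: `stub_instance` p113538 / `ToeplitzCornerTwo`). -/
theorem honestSP_all_r (r : ℕ) (hr : 1 ≤ r) :
    ∃ (N : ℕ) (T : Fin r → Fin r → Matrix (Fin N) (Fin N) ℂ), SplitSP r N 1 T := by
  sorry

/-- `WidthOneLaw` ("width one ⇒ r ≤ 2") is FALSE. -/
theorem not_widthOneLaw : ¬ WidthOneLaw := by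
  intro h
  obtain ⟨N, T, hT⟩ := honestSP_all_r 3 (by norm_num)
  have := h 3 N T hT
  omega

/-- EVERY polynomial size-free neutral law `r ≤ c (d+1)^k` is FALSE (take `d = 1`, `r = c·2^k + 1`). -/
theorem not_splitNeutralLaw (c k : ℕ) : ¬ SplitNeutralLaw c k := by
  intro h
  obtain ⟨N, T, hT⟩ := honestSP_all_r (c * 2 ^ k + 1) (by omega)
  have := h (c * 2 ^ k + 1) N 1 T hT
  norm_num at this

/-- In particular the conjectured law of ends `SplitNeutralLaw 4 1` is FALSE, and the bridge `splitNeutralLaw_refutes`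
can never fire: the negation door of the crux, as typed, is closed. -/
theorem not_lawOfEnds : ¬ LawOfEnds := not_splitNeutralLaw 4 1

/-- The honest HANKEL instance at `r = 3` (typed; it is `r3Instance` flipped by the reversal matrix `J`, `N = 105`):
some placement `W` gives a generically nonsingular Hankel pencil on `M_3` singular on every singular `X`. -/
theorem hankel_instance_three :
    ∃ (N : ℕ) (W : ℕ → Matrix (Fin 3) (Fin 3) ℂ),
      (∃ X₀ : Matrix (Fin 3) (Fin 3) ℂ, (hankelPencil 3 N W X₀).det ≠ 0) ∧
      ∀ X : Matrix (Fin 3) (Fin 3) ℂ, X.det = 0 → (hankelPencil 3 N W X).det = 0 := by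
  sorry

/-- `HonestHankelRankLeTwo` — "the Negative-lemma target all three triagers name" — is FALSE. -/
theorem not_honestHankelRankLeTwo : ¬ HonestHankelRankLeTwo := by
  intro h
  obtain ⟨N, W, hX₀, hS⟩ := hankel_instance_three
  have := h 3 N W hX₀ hS
  omega

/-! ## 3. The explicit `r = 3` design (`N = 105`) -/

/-- Step labelling of the `r = 3`, `N = 105` design found by `exp/design_split2.py` and certified by `exp/verify_r3.py`:
subdiagonal `k` carries the listed signed entry of `X` (steps = `k + 1`):
`39:−X₀₀, 31:−X₁₁, 32:+X₂₂, 27:+X₁₂, 36:+X₂₁, 25:+X₀₁, 45:−X₁₀, 50:+X₂₀, 29:+X₀₂, 37:+X₁₀, 42:+X₂₀`.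
The six designed triples of steps (one per `σ ∈ S₃`) are `{40,32,33}, {40,28,37}, {26,46,33}, {26,28,51}, {30,38,37}, {30,32,43}`,
all summing to `105`, and NO other multiset of the eleven steps sums to `105` (coin-change count = 6). -/
def r3Label (k : ℕ) : Matrix (Fin 3) (Fin 3) ℂ →ₗ[ℂ] ℂ :=
  if k = 39 then -(entryForm 3 0 0) else
  if k = 31 then -(entryForm 3 1 1) else
  if k = 32 then entryForm 3 2 2 else
  if k = 27 then entryForm 3 1 2 else
  if k = 36 then entryForm 3 2 1 else
  if k = 25 then entryForm 3 0 1 else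
  if k = 45 then -(entryForm 3 1 0) else
  if k = 50 then entryForm 3 2 0 else
  if k = 29 then entryForm 3 0 2 else
  if k = 37 then entryForm 3 1 0 else
  if k = 42 then entryForm 3 2 0 else 0

/-- The explicit honest Toeplitz pencil on `M_3` of size `105` (superdiagonal `−X₀₀`). -/
def r3Instance (X : Matrix (Fin 3) (Fin 3) ℂ) : Matrix (Fin 105) (Fin 105) ℂ :=
  hessPencil 3 105 r3Label (entryForm 3 0 0) X

/-- **Prover target (machine-checked in `exp/verify_r3.py`, exact arithmetic mod `2^61 − 1` at random points, plus the
combinatorial certificate):** `det r3Instance X = 6 · X₀₀^102 · det X`.  Hence `r3Instance` is generically nonsingular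
(`det = 6` at `X = 1`) and singular on every singular `X`: the first honest `r = 3` SP pencil on record
(`Theorems H–K` of `HonestHankelNoGo.md` exclude `N ≤ 8–9`; this sits at `N = 105`). -/
theorem r3Instance_det (X : Matrix (Fin 3) (Fin 3) ℂ) :
    (r3Instance X).det = 6 * (X 0 0) ^ 102 * X.det := by
  sorry

/-! ## 4. The one-sided class is exponentially far from the budget -/

/-- **Theorem L (typed; census §2).**  If a lower-Hessenberg honest pencil (`hessPencil`, any step labelling, any `ℓ`) is
generically nonsingular and singular on `det X = 0`, then `C(2r, r) ≤ (N+1)^3`, i.e. `N ≥ 4^{r/3 − o(r)}`.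
Source: Andrews–Forbes 2022 (arXiv:2112.00792) Thm 1.3 — every nonzero `f ∈ (det_r)` has `dim ∂_{<∞} f ≥ C(2r,r)` — applied to
`f = det hessPencil = Σ_m ℓ^{N−m} [t^N] A_X(t)^m`, all of whose partial derivatives lie in
`span{ℓ^e [t^N](A_X(t)^u t^s) : e, u, s ≤ N}` (dimension `≤ (N+1)^3`).  For EXACT designs (`det = c ℓ^{N−r} det X`, `ℓ`
an independent form) the sharper count `C(r,k)^2 ≤ k N` (`k = ⌊r/2⌋`) holds. -/
theorem oneSided_lower_bound (r N : ℕ) (a : ℕ → (Matrix (Fin r) (Fin r) ℂ →ₗ[ℂ] ℂ))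
    (ℓ : Matrix (Fin r) (Fin r) ℂ →ₗ[ℂ] ℂ)
    (hgen : ∃ X₀ : Matrix (Fin r) (Fin r) ℂ, (hessPencil r N a ℓ X₀).det ≠ 0)
    (hSP : ∀ X : Matrix (Fin r) (Fin r) ℂ, X.det = 0 → (hessPencil r N a ℓ X).det = 0) :
    Nat.choose (2 * r) r ≤ (N + 1) ^ 3 := by
  sorry

end Summit.MatrixMultiplication.MatrixMultiplication.Cruxes.HiddenCorners.CompositionDesigns
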